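import Summits.BirchSwinnertonDyer.Rank1Residual.Additive.X4RankZeroQuadraticBranchLower
import HarnessLib

/-!
# X4♯(G-ord) ∩ `I₀*` ∧ `r = 0`, END TO END at EVERY odd `p` WITHOUT the exact-leading-term input:
# OUR `E♭`-level Λ-adic conjecture + Delbourgo 2002 (A)+(B) ⟹ the LOWER half — and `BSD(E,p)` — on
# the non-anomalous, non-CM rows (cell `b2b-bsdres`, team n1011, seat p07 (gen 2), row T-N10-low
# NEXT (a′); sequel of `X4RankZeroQuadraticBranchLower.lean` §2–§3)

HONEST FRAMING (cell `b2b-bsdres`, run/shared/lean/b2b/bsd-rank1-residual/, verbatim in every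
file): the goal of the cell is to DELETE the COMBINATION-SHAPED residual classes of the
Birch–Swinnerton-Dyer formula for ALL analytic-rank `≤ 1` elliptic curves over `ℚ` — "full BSD
formula for every rank `≤ 1` curve in class `C`" assembled STRICTLY from published theorems — so
that the rank-`≤ 1` remainder becomes exactly the CONSTRUCTION-SHAPED classes, which are TYPED
(missing-input `Prop`s), NOT attempted. This is not "finishing BSD". Team n1011 (RESIDUAL-MAP §I
N10 / N11): prove what is provable now; shrink each hard class to its core with data; no claim
beyond stated classes. Research route on the CONSTRUCTION-SHAPED item N10 ((G-ord, `e = 2`) cell,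
`p ≥ 5`) and the (G-ord)@3 share of N11's LOWER clause; both stay CONSTRUCTION; nothing is booked;
no label moves. Theorems only — compositions of landed kernel theorems with OUR conjecture
`Additive.QuadraticBranchLowerDivisibilityAt` (seat p10, `@[conjecture] def`, NOT in print, nothing
asserted) taken as an explicit hypothesis; no definition, no new named fact (the Literature inputs
are the explicit binders `hDel02 : Delbourgo2002.mainTheorem` (A175, `p ≥ 5`) and
`hDel3 : Delbourgo2002.mainTheorem_three`).

## What this file proves

`X4RankZeroQuadraticBranchLower.lean` §2 reached the (G-ord, `e = 2`) rows at every odd `p` GIVEN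
n1011-p18's typed second input `ExactLeadingTermAt W p` (OPEN), and §3 removed that input at `p = 3`
through Delbourgo 2002 at `3` (n1011-p16). Here the same removal is done at EVERY odd `p`: at
`p ≥ 5` through Delbourgo 2002 (A)+(B) (`Delbourgo2002.mainTheorem` = A175; cc-typer-2's
`N10.missingLowerBoundAt_of_cycLowerLeadingTerm_of_nonAnomalous`, additive-p2's core), at `p = 3`
through §3 — so on the NON-ANOMALOUS, NON-CM (G-ord, `e = 2`) rows the LOWER half, and with surj(p)
`BSD(E,p)`, follow from OUR ONE Λ-adic conjecture on the good ordinary twist `E♭` and PUBLISHED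
inputs only:

* §1 `TypeGOrd.cycLowerLeadingTermAt_of_quadraticBranchLower_of_semistabilityIndex_eq_two` — every
  odd `p`, both parities in one statement (`hPal` used on the even branch): the conjecture for every
  twist model ⟹ the decl of record `CycLowerLeadingTermAt W p` (the cyclotomic `T = 0` lower input).
* §2 `p ≥ 5` (A175): `ClassX4Gord.missingLowerBoundAt_rankZero_of_quadraticBranchLower_of_nonAnomalous_of_five_le`,
  `ClassX4Gord.bsdp_rankZero_of_surj_of_quadraticBranchLower_of_nonAnomalous_of_five_le` (upper half:
  Kato's branch-component reading `hK` + Delbourgo 1998 Prop. 4 `hDel`, certificate-free tower), and on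
  EVERY (G-ord, `e = 2`) row (anomalous included) the slack form
  `ClassX4Gord.padicValRat_shaAn_le_add_two_of_quadraticBranchLower_of_five_le` (`ord_p #Ш_an ≤ ord_p #Ш + 2`).
* §3 EVERY odd `p` (both Delbourgo 2002 facts carried; `hDel3` is used iff `p = 3`, `hDel02` iff
  `p ≥ 5`): `ClassX4Gord.missingLowerBoundAt_rankZero_of_quadraticBranchLower_of_nonAnomalous`,
  `ClassX4Gord.x4MissingInputAt_rankZero_of_surj_of_quadraticBranchLower_of_nonAnomalous`,
  `ClassX4Gord.bsdp_rankZero_of_surj_of_quadraticBranchLower_of_nonAnomalous`,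
  `ClassX4Gord.padicValRat_shaAn_le_add_two_of_quadraticBranchLower`.

Kernel sentence: on X4♯(G-ord) ∩ `I₀*` ∧ surj(p) ∧ `r_an = 0` ∧ non-CM ∧ non-anomalous, EVERY odd `p`,
`BSD(E,p)` ⟸ [∀ twist models `V` of `W`, `QuadraticBranchLowerDivisibilityAt V p`] — the Skinner–Urban
direction of the main conjecture of the GOOD ORDINARY curve `E♭` on the `ω^{(p−1)/2}`-component over
`ℚ(μ_{p^∞})` — and nothing else unproved. What is NOT claimed: the conjecture (OPEN everywhere); the
anomalous rows keep the slack `ℓ_p ∣ p²` (flag `Del02-ThmB-ellp-anomalous`); CM rows and the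
higher-defect (G-ord) cell (`e ∈ {3,4,6}`, no quadratic twist model) are untouched. Labels UNCHANGED;
nothing booked.

References: Delbourgo 2002 [Delbourgo2002] Theorem (A), (B) (p. 40), Hypothesis (p. 39), ℓ_p(E)
(p. 39); Delbourgo 1998 [Delbourgo1998] Prop. 4 (p. 144), Main Conjecture (p. 151) (shape); Kato 2004
[Kato2004Asterisque] Thm. 17.4 (3); Pal 2012 [Pal2012] Thm. 3.2; Mazur–Tate–Teitelbaum 1986
[MazurTateTeitelbaum1986Invent] §I.13–I.14; Miller 2011 [Miller2011LMS] Def. 1.1; Skinner–Urban 2014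
[SkinnerUrban2014] Thm. 3.6.4 (shape only).
-/

noncomputable section

open scoped Classical MatrixGroups ModularForm NumberField

open CongruenceSubgroup WeierstrassCurve NumberField Literature.NumberTheory.EllipticCurves
  Literature.NumberTheory.EllipticCurves.ModularForms
  Literature.NumberTheory.EllipticCurves.Rank1Residual
  Literature.NumberTheory.EllipticCurves.Rank1Residual.Typed
  IsDedekindDomain Rat.HeightOneSpectrum

namespace Summit.BirchSwinnertonDyer.Rank1Residual.Additive

open AdditivePotMult

variable {W : WeierstrassCurve ℚ} [W.IsElliptic] [W.IsGloballyMinimal] {p : ℕ} [hp : Fact p.Prime]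

/-! ### §1 Every odd `p`: the conjecture ⟹ the cyclotomic `T = 0` input of record on (G-ord, `e = 2`) -/

/-- **(G-ord, `e = 2`), EVERY odd `p`, both parities: OUR conjecture for every twist model ⟹ the decl
of record `CycLowerLeadingTermAt W p`.** Chain: seat p10's descent to the `T = 0` branch input of the
parity of `(p−1)/2` (`chiBranchLowerLeadingTerm[Odd]At_of_quadraticBranchLower`; good-ordinary
constant term `α⁻¹∑(a/p)[a/p]^±`), then this seat's bridge
`cycLowerLeadingTermAt_iff_chiBranchLower[Odd]_of_typeGOrd_of_semistabilityIndex_eq_two` (Birch + Pal;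
`hPal` on the even branch, Pal for `d < 0` proved). [cite: Pal2012, Thm. 3.2]
[cite: MazurTateTeitelbaum1986Invent, §I.13–I.14] [cite: Delbourgo1998, Main Conjecture (p. 151) (shape only; nothing asserted)] -/
theorem TypeGOrd.cycLowerLeadingTermAt_of_quadraticBranchLower_of_semistabilityIndex_eq_two
    (hPal : Pal2012.thm32_sqrt_mul_realPeriodRat_twist_eq_of_prime_one_mod_four)
    (hmod : hasEntireLFunction_rat) (hmodD : nonempty_modularParametrizationData)
    (hp2 : p ≠ 2) (hadd : Addv W p) (hG : TypeGOrd W p) (he : semistabilityIndex W p = 2)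
    (hc : ∀ (V : WeierstrassCurve ℚ) [V.IsElliptic] [V.IsGloballyMinimal],
      (∃ C : VariableChange ℚ, C • V.quadraticTwist ((-1) ^ (p / 2) * p : ℚ) = W) →
        QuadraticBranchLowerDivisibilityAt V p) :
    CycLowerLeadingTermAt W p := by
  obtain ⟨k, hk⟩ : Odd p := hp.out.odd_of_ne_two hp2
  rcases (show p % 4 = 1 ∨ p % 4 = 3 by omega) with hp4 | hp4
  · exact (cycLowerLeadingTermAt_iff_chiBranchLower_of_typeGOrd_of_semistabilityIndex_eq_two W p hPal
      hmod hmodD hp4 hadd hG he).mpr (chiBranchLowerLeadingTermAt_of_quadraticBranchLower W p hc)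
  · exact (cycLowerLeadingTermAt_iff_chiBranchLowerOdd_of_typeGOrd_of_semistabilityIndex_eq_two W p
      hmod hmodD hp4 hadd hG he).mpr (chiBranchLowerLeadingTermOddAt_of_quadraticBranchLower W p hc)

/-! ### §2 `p ≥ 5`: the exact input replaced by Delbourgo 2002 (A)+(B) (A175) -/

/-- **X4♯(G-ord) ∩ `I₀*`, `p ≥ 5`, `r_an = 0`, non-CM, OFF the anomalous rows: OUR conjecture ⟹
`Typed.MissingLowerBoundAt W p`** — §1 then cc-typer-2's
`N10.missingLowerBoundAt_of_cycLowerLeadingTerm_of_nonAnomalous` (Delbourgo 2002 (A)+(B) `hDel02`,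
`ℓ_p = 1` off the anomalous rows; GZK; modularity). NO exact-leading-term, image, certificate,
Tamagawa or Manin hypothesis. [cite: Delbourgo2002, Theorem (A), (B) (p. 40), Hypothesis (p. 39)]
[cite: Pal2012, Thm. 3.2] [cite: Miller2011LMS, Def. 1.1] -/
theorem ClassX4Gord.missingLowerBoundAt_rankZero_of_quadraticBranchLower_of_nonAnomalous_of_five_le
    (hDel02 : Delbourgo2002.mainTheorem)
    (hPal : Pal2012.thm32_sqrt_mul_realPeriodRat_twist_eq_of_prime_one_mod_four)
    (hGZK : rank_eq_analyticRank_of_analyticRank_le_one) (hmod : hasEntireLFunction_rat)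
    (hmodD : nonempty_modularParametrizationData)
    (hX : ClassX4Gord W p) (he : semistabilityIndex W p = 2) (hcm : ¬ W.HasCM) (hp5 : 5 ≤ p)
    (hr : W.analyticRank = 0) (hna : Delbourgo2002.ReductionNonAnomalous W p)
    (hc : ∀ (V : WeierstrassCurve ℚ) [V.IsElliptic] [V.IsGloballyMinimal],
      (∃ C : VariableChange ℚ, C • V.quadraticTwist ((-1) ^ (p / 2) * p : ℚ) = W) →
        QuadraticBranchLowerDivisibilityAt V p) :
    MissingLowerBoundAt W p :=
  N10.missingLowerBoundAt_of_cycLowerLeadingTerm_of_nonAnomalous W p hDel02 hGZK hmod hp5 hcm hX.addv.2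
    hX.typeGOrd hr hna
    (hX.typeGOrd.cycLowerLeadingTermAt_of_quadraticBranchLower_of_semistabilityIndex_eq_two hPal hmod
      hmodD hX.addv.1 hX.addv.2 he hc)

/-- **X4♯(G-ord) ∩ `I₀*` ∧ surj(p), `p ≥ 5`, `r_an = 0`, non-CM, non-anomalous: `BSD(E,p)` ⟸ OUR
conjecture ALONE among unproved inputs** — upper half: Kato's divisibility on the
`ω^{(p−1)/2}`-component of `E♭` (`hK`) + Delbourgo 1998 Prop. 4 (`hDel`) with the tower from surj(p)
(n1011-p14; `ClassX4Gord.bsdp_rankZero_of_katoComponent_of_surj_of_lower`); lower half: §2. Nothing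
booked. [cite: Delbourgo2002, Theorem (A), (B) (p. 40)] [cite: Kato2004Asterisque, Thm. 17.4 (3) (p. 273)]
[cite: Delbourgo1998, Prop. 4 (p. 144)] [cite: Miller2011LMS, §1 and Def. 1.1] -/
theorem ClassX4Gord.bsdp_rankZero_of_surj_of_quadraticBranchLower_of_nonAnomalous_of_five_le
    (hDel02 : Delbourgo2002.mainTheorem)
    (hK : Kato2004.charIdeal_dvd_padicLFunctionBranch_component_of_surjective)
    (hDel : Delbourgo1998.prop4_rankZero_pow_dvd_constantCoeff)
    (hPal : Pal2012.thm32_sqrt_mul_realPeriodRat_twist_eq_of_prime_one_mod_four)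
    (hGZK : rank_eq_analyticRank_of_analyticRank_le_one) (hmod : hasEntireLFunction_rat)
    (hmodD : nonempty_modularParametrizationData)
    (hX : ClassX4Gord W p) (he : semistabilityIndex W p = 2) (hcm : ¬ W.HasCM) (hp5 : 5 ≤ p)
    (hr : W.analyticRank = 0) (hsurj : Surj W p) (hna : Delbourgo2002.ReductionNonAnomalous W p)
    (hc : ∀ (V : WeierstrassCurve ℚ) [V.IsElliptic] [V.IsGloballyMinimal],
      (∃ C : VariableChange ℚ, C • V.quadraticTwist ((-1) ^ (p / 2) * p : ℚ) = W) →
        QuadraticBranchLowerDivisibilityAt V p) :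
    BSDp W p :=
  ClassX4Gord.bsdp_rankZero_of_katoComponent_of_surj_of_lower hK hDel hGZK hmod hmodD hX he hr hsurj
    (ClassX4Gord.missingLowerBoundAt_rankZero_of_quadraticBranchLower_of_nonAnomalous_of_five_le hDel02
      hPal hGZK hmod hmodD hX he hcm hp5 hr hna hc)

/-- **X4♯(G-ord) ∩ `I₀*`, `p ≥ 5`, `r_an = 0`, non-CM, EVERY row (anomalous included): OUR conjecture
⟹ `#Ш_an(E) = q` with `ord_p q ≤ ord_p #Ш(E) + 2`** (Delbourgo's `ℓ_p ∣ p²`; cc-typer-2's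
`N10.padicValRat_shaAn_le_add_two_of_cycLowerLeadingTerm`). [cite: Delbourgo2002, Theorem (A), (B) (p. 40), ℓ_p(E) (p. 39)] -/
theorem ClassX4Gord.padicValRat_shaAn_le_add_two_of_quadraticBranchLower_of_five_le
    (hDel02 : Delbourgo2002.mainTheorem)
    (hPal : Pal2012.thm32_sqrt_mul_realPeriodRat_twist_eq_of_prime_one_mod_four)
    (hGZK : rank_eq_analyticRank_of_analyticRank_le_one) (hmod : hasEntireLFunction_rat)
    (hmodD : nonempty_modularParametrizationData)
    (hX : ClassX4Gord W p) (he : semistabilityIndex W p = 2) (hcm : ¬ W.HasCM) (hp5 : 5 ≤ p)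
    (hr : W.analyticRank = 0)
    (hc : ∀ (V : WeierstrassCurve ℚ) [V.IsElliptic] [V.IsGloballyMinimal],
      (∃ C : VariableChange ℚ, C • V.quadraticTwist ((-1) ^ (p / 2) * p : ℚ) = W) →
        QuadraticBranchLowerDivisibilityAt V p) :
    ∃ q : ℚ, shaAn W = (q : ℂ) ∧ padicValRat p q ≤ padicValNat p W.shaOrder + 2 :=
  N10.padicValRat_shaAn_le_add_two_of_cycLowerLeadingTerm W p hDel02 hGZK hmod hp5 hcm hX.addv.2
    hX.typeGOrd hr
    (hX.typeGOrd.cycLowerLeadingTermAt_of_quadraticBranchLower_of_semistabilityIndex_eq_two hPal hmod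
      hmodD hX.addv.1 hX.addv.2 he hc)

/-! ### §3 EVERY odd `p`: both Delbourgo 2002 facts carried (`hDel3` at `p = 3`, `hDel02` at `p ≥ 5`) -/

/-- **X4♯(G-ord) ∩ `I₀*`, EVERY odd `p`, `r_an = 0`, non-CM, OFF the anomalous rows: OUR conjecture ⟹
`Typed.MissingLowerBoundAt W p`** — `p = 3`: n1011-p16's (G-ord)@3 chain over
`Delbourgo2002.mainTheorem_three` (`hDel3`); `p ≥ 5`: §2 over `Delbourgo2002.mainTheorem` (`hDel02`).
Exactly one of the two facts is used at a given `p`. [cite: Delbourgo2002, Theorem (A), (B) (p. 40), Hypothesis (p. 39)]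
[cite: Pal2012, Thm. 3.2] [cite: Miller2011LMS, Def. 1.1] -/
theorem ClassX4Gord.missingLowerBoundAt_rankZero_of_quadraticBranchLower_of_nonAnomalous
    (hDel3 : Delbourgo2002.mainTheorem_three) (hDel02 : Delbourgo2002.mainTheorem)
    (hPal : Pal2012.thm32_sqrt_mul_realPeriodRat_twist_eq_of_prime_one_mod_four)
    (hGZK : rank_eq_analyticRank_of_analyticRank_le_one) (hmod : hasEntireLFunction_rat)
    (hmodD : nonempty_modularParametrizationData)
    (hX : ClassX4Gord W p) (he : semistabilityIndex W p = 2) (hcm : ¬ W.HasCM)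
    (hr : W.analyticRank = 0) (hna : Delbourgo2002.ReductionNonAnomalous W p)
    (hc : ∀ (V : WeierstrassCurve ℚ) [V.IsElliptic] [V.IsGloballyMinimal],
      (∃ C : VariableChange ℚ, C • V.quadraticTwist ((-1) ^ (p / 2) * p : ℚ) = W) →
        QuadraticBranchLowerDivisibilityAt V p) :
    MissingLowerBoundAt W p := by
  have hLow : CycLowerLeadingTermAt W p :=
    hX.typeGOrd.cycLowerLeadingTermAt_of_quadraticBranchLower_of_semistabilityIndex_eq_two hPal hmod
      hmodD hX.addv.1 hX.addv.2 he hc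
  by_cases hp3 : p = 3
  · subst hp3
    exact ClassX4Gord.missingLowerBoundAt_three_rankZero_of_cycLower_of_nonAnomalous hDel3 hGZK hmod hX
      hcm hr hna hLow
  · exact N10.missingLowerBoundAt_of_cycLowerLeadingTerm_of_nonAnomalous W p hDel02 hGZK hmod
      (hp.out.five_le_of_ne_two_of_ne_three hX.addv.1 hp3) hcm hX.addv.2 hX.typeGOrd hr hna hLow

/-- **X4♯(G-ord) ∩ `I₀*` ∧ surj(p), EVERY odd `p`, `r_an = 0`, non-CM, non-anomalous: OUR conjecture ⟹
`Typed.X4.MissingInputAt W p`** (upper half: Kato component `hK` + Delbourgo 1998 Prop. 4 `hDel`,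
certificate-free tower; `ClassX4Gord.missingInputAt_iff_lower_rankZero_of_katoComponent_of_surj`).
[cite: Delbourgo2002, Theorem (A), (B) (p. 40)] [cite: Kato2004Asterisque, Thm. 17.4 (3) (p. 273)]
[cite: Delbourgo1998, Prop. 4 (p. 144)] -/
theorem ClassX4Gord.x4MissingInputAt_rankZero_of_surj_of_quadraticBranchLower_of_nonAnomalous
    (hDel3 : Delbourgo2002.mainTheorem_three) (hDel02 : Delbourgo2002.mainTheorem)
    (hK : Kato2004.charIdeal_dvd_padicLFunctionBranch_component_of_surjective)
    (hDel : Delbourgo1998.prop4_rankZero_pow_dvd_constantCoeff)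
    (hPal : Pal2012.thm32_sqrt_mul_realPeriodRat_twist_eq_of_prime_one_mod_four)
    (hGZK : rank_eq_analyticRank_of_analyticRank_le_one) (hmod : hasEntireLFunction_rat)
    (hmodD : nonempty_modularParametrizationData)
    (hX : ClassX4Gord W p) (he : semistabilityIndex W p = 2) (hcm : ¬ W.HasCM)
    (hr : W.analyticRank = 0) (hsurj : Surj W p) (hna : Delbourgo2002.ReductionNonAnomalous W p)
    (hc : ∀ (V : WeierstrassCurve ℚ) [V.IsElliptic] [V.IsGloballyMinimal],
      (∃ C : VariableChange ℚ, C • V.quadraticTwist ((-1) ^ (p / 2) * p : ℚ) = W) →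
        QuadraticBranchLowerDivisibilityAt V p) :
    X4.MissingInputAt W p :=
  (ClassX4Gord.missingInputAt_iff_lower_rankZero_of_katoComponent_of_surj hK hDel hGZK hmod hmodD hX he
      hr hsurj).mpr
    (ClassX4Gord.missingLowerBoundAt_rankZero_of_quadraticBranchLower_of_nonAnomalous hDel3 hDel02 hPal
      hGZK hmod hmodD hX he hcm hr hna hc)

/-- **X4♯(G-ord) ∩ `I₀*` ∧ surj(p), EVERY odd `p` (`p = 3` included), `r_an = 0`, non-CM,
non-anomalous: `BSD(E,p)` ⟸ OUR conjecture ALONE among unproved inputs** — the (G-ord, `e = 2`)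
end-to-end sentence of N10 / N11-LOWER: granted Kato 17.4 (3) on the component (`hK`), Delbourgo
1998 Prop. 4 (`hDel`), Delbourgo 2002 (`hDel3` / `hDel02`), Pal (`hPal`), GZK and modularity, the
ONE missing input on these rows is the Skinner–Urban direction of the main conjecture of the good
ordinary twist `E♭` on the `ω^{(p−1)/2}`-component over `ℚ(μ_{p^∞})`. X4♯(G-ord) stays
CONSTRUCTION-SHAPED; nothing booked. [cite: Delbourgo2002, Theorem (A), (B) (p. 40)]
[cite: Kato2004Asterisque, Thm. 17.4 (3) (p. 273)] [cite: Delbourgo1998, Prop. 4 (p. 144)]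
[cite: Pal2012, Thm. 3.2] [cite: Miller2011LMS, §1 and Def. 1.1] -/
theorem ClassX4Gord.bsdp_rankZero_of_surj_of_quadraticBranchLower_of_nonAnomalous
    (hDel3 : Delbourgo2002.mainTheorem_three) (hDel02 : Delbourgo2002.mainTheorem)
    (hK : Kato2004.charIdeal_dvd_padicLFunctionBranch_component_of_surjective)
    (hDel : Delbourgo1998.prop4_rankZero_pow_dvd_constantCoeff)
    (hPal : Pal2012.thm32_sqrt_mul_realPeriodRat_twist_eq_of_prime_one_mod_four)
    (hGZK : rank_eq_analyticRank_of_analyticRank_le_one) (hmod : hasEntireLFunction_rat)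
    (hmodD : nonempty_modularParametrizationData)
    (hX : ClassX4Gord W p) (he : semistabilityIndex W p = 2) (hcm : ¬ W.HasCM)
    (hr : W.analyticRank = 0) (hsurj : Surj W p) (hna : Delbourgo2002.ReductionNonAnomalous W p)
    (hc : ∀ (V : WeierstrassCurve ℚ) [V.IsElliptic] [V.IsGloballyMinimal],
      (∃ C : VariableChange ℚ, C • V.quadraticTwist ((-1) ^ (p / 2) * p : ℚ) = W) →
        QuadraticBranchLowerDivisibilityAt V p) :
    BSDp W p :=
  ClassX4Gord.bsdp_rankZero_of_katoComponent_of_surj_of_lower hK hDel hGZK hmod hmodD hX he hr hsurj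
    (ClassX4Gord.missingLowerBoundAt_rankZero_of_quadraticBranchLower_of_nonAnomalous hDel3 hDel02 hPal
      hGZK hmod hmodD hX he hcm hr hna hc)

/-- **X4♯(G-ord) ∩ `I₀*`, EVERY odd `p`, `r_an = 0`, non-CM, EVERY row (anomalous included): OUR
conjecture ⟹ `#Ш_an(E) = q` with `ord_p q ≤ ord_p #Ш(E) + 2`** (`p = 3`: n1011-p16's slack form;
`p ≥ 5`: §2). [cite: Delbourgo2002, Theorem (A), (B) (p. 40), ℓ_p(E) (p. 39)] -/
theorem ClassX4Gord.padicValRat_shaAn_le_add_two_of_quadraticBranchLower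
    (hDel3 : Delbourgo2002.mainTheorem_three) (hDel02 : Delbourgo2002.mainTheorem)
    (hPal : Pal2012.thm32_sqrt_mul_realPeriodRat_twist_eq_of_prime_one_mod_four)
    (hGZK : rank_eq_analyticRank_of_analyticRank_le_one) (hmod : hasEntireLFunction_rat)
    (hmodD : nonempty_modularParametrizationData)
    (hX : ClassX4Gord W p) (he : semistabilityIndex W p = 2) (hcm : ¬ W.HasCM)
    (hr : W.analyticRank = 0)
    (hc : ∀ (V : WeierstrassCurve ℚ) [V.IsElliptic] [V.IsGloballyMinimal],
      (∃ C : VariableChange ℚ, C • V.quadraticTwist ((-1) ^ (p / 2) * p : ℚ) = W) →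
        QuadraticBranchLowerDivisibilityAt V p) :
    ∃ q : ℚ, shaAn W = (q : ℂ) ∧ padicValRat p q ≤ padicValNat p W.shaOrder + 2 := by
  have hLow : CycLowerLeadingTermAt W p :=
    hX.typeGOrd.cycLowerLeadingTermAt_of_quadraticBranchLower_of_semistabilityIndex_eq_two hPal hmod
      hmodD hX.addv.1 hX.addv.2 he hc
  by_cases hp3 : p = 3
  · subst hp3
    exact hX.typeGOrd.padicValRat_shaAn_le_add_two_three_of_cycLower hDel3 hGZK hmod hX.addv.2 hcm hr
      hLow
  · exact N10.padicValRat_shaAn_le_add_two_of_cycLowerLeadingTerm W p hDel02 hGZK hmod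
      (hp.out.five_le_of_ne_two_of_ne_three hX.addv.1 hp3) hcm hX.addv.2 hX.typeGOrd hr hLow

end Summit.BirchSwinnertonDyer.Rank1Residual.Additive

end
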